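import Summits.MatrixMultiplication.MatrixMultiplication.Theorems.LevelGradedCohnUmansLevelOneGL2DesignsParabolaFreeSearch

/-!
# Parabola-free sets of `ℤ₁₁²`: the search verdicts for a largest column of size 3
(stub `stub_tangencySets` of the crux `LevelOneGL2Designs`, stmt-MatrixMultiplication-14080;
wall-breaker axis 5/12, *parabola lifts over finite fields*, family P2-mod; exactness `α₁₁ = 23`)

Kernel evaluations (`decide +kernel`, no `native_decide`) of the column branch and bound
`PFS.topA 11 24 3 A` of `…ParabolaFreeSearch.lean` for the 5 canonical column-0 sets `A` of size 3
(odd 11-bit masks, minimal in their dilation orbit), one theorem each so that every kernel run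
starts with empty caches, and their conjunction `refuteM 11 24 3 = true`: no parabola-free subset of
`ℤ₁₁ × ℤ₁₁` in normal form with a largest column of size 3 has 24 points.  Search nodes: 67529
in all (≈ 2.5 ms per node on the farm).  Consumed by `…ParabolaFreeExact11.lean`.
-/

set_option linter.dupNamespace false -- `MatrixMultiplication.MatrixMultiplication` (summit = problem, D-0017)

namespace Summit.MatrixMultiplication.MatrixMultiplication.Theorems.LevelOneGL2Designs.PFS

/-- the canonical column-0 sets of size 3 at `p = 11` -/
theorem canonA_11_3 : canonA 11 3 = [7, 11, 13, 25, 97] := by decide +kernel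

/-- search verdict at `p = 11`, `K = 24`, cap 3, column-0 set `{0, 1, 2}` (mask 7; 14569 nodes) -/
theorem topA_11_24_3_7 : topA 11 24 3 7 = false := by decide +kernel

/-- search verdict at `p = 11`, `K = 24`, cap 3, column-0 set `{0, 1, 3}` (mask 11; 12046 nodes) -/
theorem topA_11_24_3_11 : topA 11 24 3 11 = false := by decide +kernel

/-- search verdict at `p = 11`, `K = 24`, cap 3, column-0 set `{0, 2, 3}` (mask 13; 12046 nodes) -/
theorem topA_11_24_3_13 : topA 11 24 3 13 = false := by decide +kernel

/-- search verdict at `p = 11`, `K = 24`, cap 3, column-0 set `{0, 3, 4}` (mask 25; 13439 nodes) -/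
theorem topA_11_24_3_25 : topA 11 24 3 25 = false := by decide +kernel

/-- search verdict at `p = 11`, `K = 24`, cap 3, column-0 set `{0, 5, 6}` (mask 97; 15429 nodes) -/
theorem topA_11_24_3_97 : topA 11 24 3 97 = false := by decide +kernel

/-- **No normal-form parabola-free 24-set in `ℤ₁₁²` with a largest column of size 3.** -/
theorem refuteM_11_24_3 : refuteM 11 24 3 = true := by
  rw [refuteM, canonA_11_3]
  simp [topA_11_24_3_7, topA_11_24_3_11, topA_11_24_3_13, topA_11_24_3_25, topA_11_24_3_97]

end Summit.MatrixMultiplication.MatrixMultiplication.Theorems.LevelOneGL2Designs.PFS
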